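import Summits.AnomalousDissipation.AnomalousDissipation.Theorems.ImpulseGridGridThesisStubAlphaBalance
import Summits.AnomalousDissipation.AnomalousDissipation.Theorems.ImpulseGridGridThesisStubAcWorkOfQuadratureDrag
import Summits.AnomalousDissipation.AnomalousDissipation.Theorems.ImpulseGridGridThesisStubAcdcDesignCalculus
import Summits.AnomalousDissipation.AnomalousDissipation.Theorems.ImpulseGridGridThesisStubAcdcDesignIntegrals

/-!
# Birth skeleton — crux `ImpulseGrid.AcdcFirstMomentLaw` (stmt-AnomalousDissipation-18236), line `birth`

Child 1 of the AC/DC split of `GridThesis` (crux strategist of stmt-1770, 2026-08-17).  The crux is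
the FIRST-MOMENT SIGN LAW of the explicit AC/DC grid: `∃ (m, A, θ, c)` such that every bounded-energy
vanishing-viscosity Leray–Hopf drift family of the force `Φ•G` has, eventually in `j` and in one
generalized limit `Λ`, (DC) `0 ≤ Λ⟨(G,u_j)⟩` and (AC) `κ ≤ Λ⟨((Φ−1)•G,u_j)⟩`.

Two PHYSICALLY DISTINCT open stubs (neither is the crux reworded; neither is a zeroth-law witness —
both are `∀`-family laws with no existence content) and a composition with real content (the landed
modal `α`-balance of the `GridThesis` line):

* `stub_acdcNoReversalLaw` (DC; physics) — NO REVERSAL OF THE CIRCUIT-MEAN IMPRINT, universally in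
  the parameters AND in the generalized limit: for all `(m, A, θ, c)` and every bounded-energy drift
  family, eventually in `j`, `0 ≤ Λ⟨(G, u_j)⟩` for EVERY Banach mean `Λ` (i.e. the lower Cesàro
  mean of the DC amplitude is `≥ 0`).  Mechanism: the `x₀`-averaged (columnar) component is forced
  EXACTLY by the steady pattern `G` (pinned stress `Λ⟨∫⟪w,(w·∇)G⟫⟩ + 8π²m²ν·DC = 2A²`,
  GridInjectionIdentity (2)); `DC < 0` would be a sustained NEGATIVE eddy viscosity of the 3-D
  fluctuations on the forcing-scale columnar mode — excluded physically because 2-D condensation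
  needs thin layers `L∥ k_f ≲ O(1)` while here `L∥ k_f = 2π√2·m ≥ 8.9` (Celani–Musacchio–Vincenzi
  2010; Benavides–Alexakis 2017).  Why it might fail: a phase-locked transverse condensate at some
  `(m, A)`; universality in `Λ` (liminf, not one Banach mean).
* `stub_acdcAcDragLaw` (AC; physics) — AC EDDY DRAG ON THE SWEPT QUADRATURE PAIR (`∃` parameters,
  `∀` families): with `C = cos(2πx₀)G`, `S = sin(2πx₀)G`, `X = (C,u)`, `Y = (S,u)`,
  `T_P(u) = ∫⟪u,(u·∇)P⟫`, eventually `Λ⟨X·T_C(u_j) + Y·T_S(u_j)⟩ ≤ −δ < 0` — the `∀`-family form of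
  the AC clause of the `GridThesis` line's lead stub `stub_dragFamilyForAcdcGrid` (DNS j018238:
  `cov_AC = −(0.3…8)·10⁻⁴ < 0`, MORE negative as `ν ↓`).  Why it might fail: a pumped (recoiling)
  swept oscillator gives `cov_AC ≥ 0`; the margin `δ` may not be `ν`-uniform.
* `AcdcFirstMomentLaw_of` — composition: parameters and `Λ` from the AC stub; the AC-work floor
  `Λ⟨((Φ−1)•G,u_j)⟩ = 2θ·Λ⟨X⟩ ≥ 2θ·δ/(θ‖G‖₂²)` from AC drag by the EXACT modal `α`-balance
  (`stub_alphaBalance` p103160, `stub_acWorkOfQuadratureDrag` p102597: `(f,C)Λ⟨X⟩ = νμΛ⟨X²⟩ −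
  Λ⟨X·T_C⟩`, `(f,S) = 0`, `μ = 4π²(2m²+1)`, `(f,C) = θ‖G‖₂²`, design facts
  `stub_acdcDesignCalculus`/`stub_acdcDesignIntegrals` p106706/p106585); the DC sign from the
  no-reversal stub at this `Λ`; threshold `max J₁ J₂`.

Disproof used: no `Disproof.lean` is published for stmt-1770 / stmt-14349 (`ledger crux ls`,
2026-08-17); honoured by name: the arrow-of-time remark of the GridSignsLaw lead (any proof of either
stub must use `ν > 0`: both stubs keep the Leray–Hopf class and the sign enters through the energy
inequality / viscous modal terms), `firstMoment_dc_add_ac_nonneg` (p106461: DC + AC ≥ 0 is free, so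
the two stubs are not jointly vacuous in content), `gridSignsLaw_steady_necessary` (p107104).
-/

noncomputable section

open MeasureTheory Set Filter Topology
open scoped InnerProductSpace RealInnerProductSpace

-- `Summit.<Summit>.<Problem>` is the tree's mandated summit-side namespace (CONVENTIONS §2).
set_option linter.dupNamespace false

namespace Summit.AnomalousDissipation.AnomalousDissipation.Cruxes.AcdcFirstMomentLaw.Birth

open Literature.Analysis.FunctionSpaces Literature.Analysis.FunctionSpaces.Torus
open Literature.Analysis.FluidPDE Literature.Analysis.FluidPDE.Torus
open Summit.AnomalousDissipation.AnomalousDissipation.Theses.ImpulseGrid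
open Summit.AnomalousDissipation.AnomalousDissipation.Theorems

local notation "𝕋³" => UnitAddTorus (Fin 3)
local notation "E³" => EuclideanSpace ℝ (Fin 3)

/-! ### Stub 1 (DC, physics): no reversal of the circuit-mean imprint -/

/-- **Stub (physics; conjecture-grade): NO-REVERSAL LAW**, universal in the parameters of the AC/DC
grid and in the generalized limit.  [folklore] -/
theorem stub_acdcNoReversalLaw :
    ∀ (m : ℕ) (A θ c : ℝ), 1 ≤ m → 0 < A → 0 < θ → 0 < c →
      ∀ (Φ : 𝕋³ → ℝ) (G : 𝕋³ → E³),
        Φ = (fun x => 1 + 2 * θ * (UnitAddTorus.mFourier (Pi.single (0 : Fin 3) (1 : ℤ)) x).re) →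
        G = (fun x => A • (stokesMode ![(0 : ℤ), (m : ℤ), (m : ℤ)]
              (EuclideanSpace.single (1 : Fin 3) (1 : ℝ) - EuclideanSpace.single (2 : Fin 3) (1 : ℝ)) false x +
            stokesMode ![(0 : ℤ), (m : ℤ), -(m : ℤ)]
              (EuclideanSpace.single (1 : Fin 3) (1 : ℝ) + EuclideanSpace.single (2 : Fin 3) (1 : ℝ)) false x)) →
        ∀ (ν : ℕ → ℝ) (u₀ : ℕ → 𝕋³ → E³) (u : ℕ → ℝ → 𝕋³ → E³) (E : ℝ),
          (∀ j, 0 < ν j) → Tendsto ν atTop (𝓝 0) →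
          (∀ j, IsGlobalLerayHopf (ν j) (fun _ => fun x => Φ x • G x) (u₀ j) (u j)) →
          (∀ j, ∃ C : ℝ, ∀ t : ℝ, 0 ≤ t → kineticEnergy (u j t) ≤ C) →
          (∀ j, ∫ x, u₀ j x = c • EuclideanSpace.single 0 1) →
          (∀ j, meanEnergy (u j) ≤ E) →
          ∃ J : ℕ, ∀ j, J ≤ j → ∀ Λ : GeneralizedLimit,
            0 ≤ Λ.longTimeAvg (fun t => ∫ x, ⟪G x, u j t x⟫) := by
  sorry

/-! ### Stub 2 (AC, physics): AC eddy drag on the swept quadrature pair -/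

/-- **Stub (physics; conjecture-grade): AC EDDY-DRAG LAW** (`∃` parameters, `∀` bounded-energy drift
families, eventually in `j`, one generalized limit).  [folklore] -/
theorem stub_acdcAcDragLaw :
    ∃ (m : ℕ) (A θ c : ℝ), 1 ≤ m ∧ 0 < A ∧ 0 < θ ∧ 0 < c ∧
      ∀ (Φ : 𝕋³ → ℝ) (G C S : 𝕋³ → E³),
        Φ = (fun x => 1 + 2 * θ * (UnitAddTorus.mFourier (Pi.single (0 : Fin 3) (1 : ℤ)) x).re) →
        G = (fun x => A • (stokesMode ![(0 : ℤ), (m : ℤ), (m : ℤ)]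
              (EuclideanSpace.single (1 : Fin 3) (1 : ℝ) - EuclideanSpace.single (2 : Fin 3) (1 : ℝ)) false x +
            stokesMode ![(0 : ℤ), (m : ℤ), -(m : ℤ)]
              (EuclideanSpace.single (1 : Fin 3) (1 : ℝ) + EuclideanSpace.single (2 : Fin 3) (1 : ℝ)) false x)) →
        C = (fun x => (UnitAddTorus.mFourier (Pi.single (0 : Fin 3) (1 : ℤ)) x).re • G x) →
        S = (fun x => (UnitAddTorus.mFourier (Pi.single (0 : Fin 3) (1 : ℤ)) x).im • G x) →
        ∀ (ν : ℕ → ℝ) (u₀ : ℕ → 𝕋³ → E³) (u : ℕ → ℝ → 𝕋³ → E³) (E : ℝ),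
          (∀ j, 0 < ν j) → Tendsto ν atTop (𝓝 0) →
          (∀ j, IsGlobalLerayHopf (ν j) (fun _ => fun x => Φ x • G x) (u₀ j) (u j)) →
          (∀ j, ∃ C₀ : ℝ, ∀ t : ℝ, 0 ≤ t → kineticEnergy (u j t) ≤ C₀) →
          (∀ j, ∫ x, u₀ j x = c • EuclideanSpace.single 0 1) →
          (∀ j, meanEnergy (u j) ≤ E) →
          ∃ δ : ℝ, 0 < δ ∧ ∃ (Λ : GeneralizedLimit) (J : ℕ), ∀ j, J ≤ j →
            Λ.longTimeAvg (fun t =>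
              (∫ x, ⟪C x, u j t x⟫) * (∫ x, ⟪u j t x, convect (u j t) C x⟫) +
                (∫ x, ⟪S x, u j t x⟫) * (∫ x, ⟪u j t x, convect (u j t) S x⟫)) ≤ -δ := by
  sorry

/-! ### Composition: the crux BY NAME -/

/-- **`AcdcFirstMomentLaw` from the two stubs, by name** (sorry-free modulo the stubs): AC work from AC
drag by the exact modal `α`-balance, DC sign from the no-reversal law, common threshold. [folklore] -/
theorem AcdcFirstMomentLaw_of :
    Summit.AnomalousDissipation.AnomalousDissipation.Theses.ImpulseGrid.AcdcFirstMomentLaw := by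
  have hDC := stub_acdcNoReversalLaw
  have hAC := stub_acdcAcDragLaw
  obtain ⟨m, A, θ, c, hm, hA, hθ, hc, hac⟩ := hAC
  refine ⟨m, A, θ, c, hm, hA, hθ, hc, ?_⟩
  intro Φ G hΦd hGd ν u₀ u E hν hν0 hLH hsup hdrift hE
  -- the sawtooth and the swept quadrature pair of the design
  set Ψ : 𝕋³ → ℝ := fun x => θ / Real.pi * (UnitAddTorus.mFourier (Pi.single (0 : Fin 3) (1 : ℤ)) x).im
    with hΨd
  set C : 𝕋³ → E³ := fun x => (UnitAddTorus.mFourier (Pi.single (0 : Fin 3) (1 : ℤ)) x).re • G x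
    with hCd
  set S : 𝕋³ → E³ := fun x => (UnitAddTorus.mFourier (Pi.single (0 : Fin 3) (1 : ℤ)) x).im • G x
    with hSd
  obtain ⟨-, -, -, -, -, -, -, -, hfs, -, -, hCs, hSs, hCdiv, hSdiv, hΔC, hΔS, hACid⟩ :=
    stub_acdcDesignCalculus m A θ Φ Ψ G C S hΦd hΨd hGd hCd hSd hm hA hθ
  obtain ⟨-, -, hfC, hfS, -, hGpos⟩ :=
    stub_acdcDesignIntegrals m A θ Φ Ψ G C S hΦd hΨd hGd hCd hSd hm hA hθ
  -- the two laws applied to the family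
  obtain ⟨δ, hδ, Λ, J₁, hJ₁⟩ := hac Φ G C S hΦd hGd hCd hSd ν u₀ u E hν hν0 hLH hsup hdrift hE
  obtain ⟨J₂, hJ₂⟩ := hDC m A θ c hm hA hθ hc Φ G hΦd hGd ν u₀ u E hν hν0 hLH hsup hdrift hE
  have hκ : 0 < θ * ∫ x, ‖G x‖ ^ 2 := mul_pos hθ hGpos
  have hμ : 0 < 4 * Real.pi ^ 2 * (2 * (m : ℝ) ^ 2 + 1) := by positivity
  refine ⟨2 * θ * (δ / (θ * ∫ x, ‖G x‖ ^ 2)), by positivity, Λ, max J₁ J₂, fun j hj => ⟨?_, ?_⟩⟩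
  · -- (DC) no reversal, at this `Λ`
    exact hJ₂ j ((le_max_right _ _).trans hj) Λ
  · -- (AC) work floor from AC eddy drag by the exact modal balance
    have hX : δ / (θ * ∫ x, ‖G x‖ ^ 2) ≤ Λ.longTimeAvg (fun t => ∫ x, ⟪C x, u j t x⟫) :=
      stub_acWorkOfQuadratureDrag Λ (ν j) (4 * Real.pi ^ 2 * (2 * (m : ℝ) ^ 2 + 1))
        (θ * ∫ x, ‖G x‖ ^ 2) δ (fun x => Φ x • G x) C S (u₀ j) (u j) stub_alphaBalance hfs hCs hSs
        hCdiv hSdiv hΔC hΔS (mul_pos (hν j) hμ).le hfC hκ hfS (hLH j) (hsup j)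
        (hJ₁ j ((le_max_left _ _).trans hj))
    have hACwork : Λ.longTimeAvg (fun t => ∫ x, ⟪(Φ x - 1) • G x, u j t x⟫) =
        (2 * θ) * Λ.longTimeAvg (fun t => ∫ x, ⟪C x, u j t x⟫) := by
      rw [← Λ.longTimeAvg_const_mul]
      congr 1
      funext t
      rw [← integral_const_mul]
      refine integral_congr_ae (ae_of_all _ fun x => ?_)
      show ⟪(Φ x - 1) • G x, u j t x⟫ = 2 * θ * ⟪C x, u j t x⟫
      rw [hACid x, real_inner_smul_left]
    show 2 * θ * (δ / (θ * ∫ x, ‖G x‖ ^ 2)) ≤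
      Λ.longTimeAvg (fun t => ∫ x, ⟪(Φ x - 1) • G x, u j t x⟫)
    rw [hACwork]
    exact mul_le_mul_of_nonneg_left hX (by positivity)

end Summit.AnomalousDissipation.AnomalousDissipation.Cruxes.AcdcFirstMomentLaw.Birth

end
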